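import Summits.Ventures.PercRepro.MSTightPartnerNonemptyBasic

/-!
# An empty partner family at a tightening direction: the case `ρ ∈ F₀`

Dossier proofs/MINE1-theoremS.md, Addendum 55. Setting of MSTightPartnerNonemptyBasic.lean
(`P = proj r F` tight, `partner r F = ∅`, `X ∩ Y = {∅}`), with `ρ = Rstar P` an `r`-free member:

* `mem_partr_iff_union_Rstar_mem_partr`: for `q ⊄ ρ`, `q ∈ F₁ ↔ q ∪ ρ ∈ F₁`;
* `mem_part0_of_subset_Rstar`: if some `r`-member contains `ρ`, every member inside `ρ` is `r`-free
  (an `r`-member inside `ρ` grows to `ρ` through the empty core, `union_Rstar_sdiff_mem_partr`);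
* `false_of_Rstar_mem_part0_of_exists`: ... and then `∅ ∈ Y` (an `r`-member inside an `r`-free
  member) is impossible;
* `false_of_Rstar_mem_part0_of_forall`: if no `r`-member contains `ρ`, every `r`-member lies inside
  `ρ` and inside every member not inside `ρ` — against the empty core;
* `false_of_Rstar_mem_part0`: the case `ρ ∈ F₀` is impossible.
-/

namespace PercRepro.MSTight

open Finset
open scoped FinsetFamily

variable {α : Type*} [DecidableEq α] [Fintype α]

section CaseZero

variable {r : α} {F : Finset (Finset α)}

/-- **Case `ρ ∈ F₀`, (a).** A member not inside `ρ` is an `r`-member iff `q ∪ ρ` is. -/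
theorem mem_partr_iff_union_Rstar_mem_partr (hP : Tight (proj r F))
    (hXY : diffsX r F ∩ diffsY r F = {∅}) (hρ0 : Rstar (proj r F) ∈ part0 r F) {q : Finset α}
    (hq : q ∈ proj r F) (hqρ : ¬ q ⊆ Rstar (proj r F)) :
    q ∈ partr r F ↔ q ∪ Rstar (proj r F) ∈ partr r F := by
  have hρ : Rstar (proj r F) ∈ proj r F := mem_proj_of_mem_part0 hρ0
  have hz : q \ Rstar (proj r F) ≠ ∅ := fun h => hqρ (sdiff_eq_empty_iff_subset.1 h)
  have hqρP : q ∪ Rstar (proj r F) ∈ proj r F := mem_union_Rstar_of_mem hP hq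
  have e : (q ∪ Rstar (proj r F)) \ Rstar (proj r F) = q \ Rstar (proj r F) := union_sdiff_right _ _
  constructor
  · intro hq1
    have hY : q \ Rstar (proj r F) ∈ diffsY r F := sdiff_mem_diffsY_of_partr_part0 hq1 hρ0
    rw [← e] at hY hz
    exact mem_partr_of_sdiff_mem_diffsY hXY hqρP hρ hz hY
  · intro hq1
    have hY : (q ∪ Rstar (proj r F)) \ Rstar (proj r F) ∈ diffsY r F :=
      sdiff_mem_diffsY_of_partr_part0 hq1 hρ0
    rw [e] at hY
    exact mem_partr_of_sdiff_mem_diffsY hXY hq hρ hz hY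

/-- **Case `ρ ∈ F₀`, (b) step.** With an `r`-member `a ⊇ ρ`, an `r`-member `b ⊆ ρ` grows to the
`r`-member `b ∪ (ρ \ c)` for every member `c ⊆ ρ`. -/
theorem union_Rstar_sdiff_mem_partr (hP : Tight (proj r F)) (hK : partner r F = ∅)
    (hXY : diffsX r F ∩ diffsY r F = {∅}) (hρ0 : Rstar (proj r F) ∈ part0 r F) {a : Finset α}
    (ha : a ∈ partr r F) (hρa : Rstar (proj r F) ⊆ a) {b : Finset α} (hb : b ∈ partr r F)
    (hbρ : b ⊆ Rstar (proj r F)) {c : Finset α} (hc : c ∈ proj r F)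
    (hcρ : c ⊆ Rstar (proj r F)) : b ∪ (Rstar (proj r F) \ c) ∈ partr r F := by
  have hρ : Rstar (proj r F) ∈ proj r F := mem_proj_of_mem_part0 hρ0
  have haP : a ∈ proj r F := mem_proj_of_mem_partr ha
  have hbP : b ∈ proj r F := mem_proj_of_mem_partr hb
  have haρ : a ≠ Rstar (proj r F) := fun h => not_mem_partr_of_mem_part0 hK hρ0 (h ▸ ha)
  have hz0 : a \ Rstar (proj r F) ≠ ∅ := fun h =>
    haρ (Subset.antisymm (sdiff_eq_empty_iff_subset.1 h) hρa)
  obtain ⟨x₀, hx₀⟩ := nonempty_iff_ne_empty.2 hz0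
  -- `q' := (a \ ρ) ∪ c` is an `r`-member, because `q' ∪ ρ = a`
  have hq'P : (a \ Rstar (proj r F)) ∪ c ∈ proj r F := by
    have h := sdiff_Rstar_union_inter_Rstar_mem hP haP hc
    rwa [inter_eq_left.2 hcρ] at h
  have hq'nρ : ¬ (a \ Rstar (proj r F)) ∪ c ⊆ Rstar (proj r F) := fun h =>
    (mem_sdiff.1 hx₀).2 (h (mem_union_left _ hx₀))
  have hq'1 : (a \ Rstar (proj r F)) ∪ c ∈ partr r F := by
    rw [mem_partr_iff_union_Rstar_mem_partr hP hXY hρ0 hq'P hq'nρ,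
      sdiff_union_union_eq_of_subset hρa hcρ]
    exact ha
  -- `w := b ∪ (ρ \ c)` is a member
  have hwP : b ∪ (Rstar (proj r F) \ c) ∈ proj r F := by
    rw [mem_iff_parts hP, union_sdiff_sdiff_eq_empty_of_subset hbρ,
      sdiff_union_sdiff_eq_of_subset hcρ]
    exact ⟨mem_diffs.2 ⟨Rstar (proj r F), hρ, Rstar (proj r F), hρ, Finset.sdiff_self _⟩,
      mem_diffs.2 ⟨c, hc, b, hbP, rfl⟩⟩
  -- `q' \ b = a \ w` is a nonempty difference of two `r`-members, hence not of type I
  have hzne : ((a \ Rstar (proj r F)) ∪ c) \ b ≠ ∅ := by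
    intro h
    have h' := sdiff_eq_empty_iff_subset.1 h (mem_union_left _ hx₀)
    exact (mem_sdiff.1 hx₀).2 (hbρ h')
  have hnY : ((a \ Rstar (proj r F)) ∪ c) \ b ∉ diffsY r F :=
    sdiff_notMem_diffsY_of_partr_right hXY hq'P hb hzne
  rw [sdiff_union_sdiff_eq_sdiff_union_of_subset hρa hcρ hbρ] at hnY
  exact mem_partr_of_sdiff_notMem_diffsY ha hwP hnY

/-- **Case `ρ ∈ F₀`, (b).** If some `r`-member contains `ρ`, every member inside `ρ` is
`r`-free (the empty core grows an `r`-member inside `ρ` up to `ρ` itself). -/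
theorem mem_part0_of_subset_Rstar (hP : Tight (proj r F)) (hK : partner r F = ∅)
    (hXY : diffsX r F ∩ diffsY r F = {∅}) (hρ0 : Rstar (proj r F) ∈ part0 r F)
    (hcore : ∀ a, ∃ p ∈ proj r F, a ∉ p) {a : Finset α} (ha : a ∈ partr r F)
    (hρa : Rstar (proj r F) ⊆ a) :
    ∀ b ∈ proj r F, b ⊆ Rstar (proj r F) → b ∈ part0 r F := by
  suffices h : ∀ k : ℕ, ∀ b ∈ proj r F, b ⊆ Rstar (proj r F) →
      (Rstar (proj r F) \ b).card = k → b ∈ part0 r F from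
    fun b hb hbρ => h _ b hb hbρ rfl
  intro k
  induction k using Nat.strong_induction_on with
  | _ k ih =>
  intro b hb hbρ hk
  by_contra hb0
  have hb1 : b ∈ partr r F := mem_partr_of_notMem_part0 hb hb0
  have hbρ' : b ≠ Rstar (proj r F) := fun h => not_mem_partr_of_mem_part0 hK hρ0 (h ▸ hb1)
  obtain ⟨m, hmρ, hmb⟩ : ∃ m ∈ Rstar (proj r F), m ∉ b := by
    by_contra hcon
    push Not at hcon
    exact hbρ' (Subset.antisymm hbρ hcon)
  obtain ⟨p, hp, hmp⟩ := hcore m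
  have hcP : p ∩ Rstar (proj r F) ∈ proj r F := inter_Rstar_mem hP hp
  have hcρ : p ∩ Rstar (proj r F) ⊆ Rstar (proj r F) := inter_subset_right
  have hb' : b ∪ (Rstar (proj r F) \ (p ∩ Rstar (proj r F))) ∈ partr r F :=
    union_Rstar_sdiff_mem_partr hP hK hXY hρ0 ha hρa hb1 hbρ hcP hcρ
  have hb'ρ : b ∪ (Rstar (proj r F) \ (p ∩ Rstar (proj r F))) ⊆ Rstar (proj r F) :=
    union_subset hbρ sdiff_subset
  have hlt : (Rstar (proj r F) \ (b ∪ (Rstar (proj r F) \ (p ∩ Rstar (proj r F))))).card < k := by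
    rw [← hk]
    apply card_lt_card
    rw [ssubset_iff_of_subset (sdiff_subset_sdiff (Subset.refl _) subset_union_left)]
    refine ⟨m, mem_sdiff.2 ⟨hmρ, hmb⟩, fun h => (mem_sdiff.1 h).2 ?_⟩
    exact mem_union_right _ (mem_sdiff.2 ⟨hmρ, fun h' => hmp (mem_inter.1 h').1⟩)
  exact not_mem_partr_of_mem_part0 hK (ih _ hlt _ (mem_proj_of_mem_partr hb') hb'ρ rfl) hb'

/-- **Case `ρ ∈ F₀`, (c).** With an `r`-member containing `ρ`, no `r`-member lies inside an
`r`-free member: `∅ ∉ Y`. -/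
theorem false_of_Rstar_mem_part0_of_exists (hP : Tight (proj r F)) (hK : partner r F = ∅)
    (hXY : diffsX r F ∩ diffsY r F = {∅}) (hρ0 : Rstar (proj r F) ∈ part0 r F)
    (hE : (∅ : Finset α) ∉ proj r F) (hcore : ∀ a, ∃ p ∈ proj r F, a ∉ p) {a : Finset α}
    (ha : a ∈ partr r F) (hρa : Rstar (proj r F) ⊆ a) (h0 : (∅ : Finset α) ∈ diffsY r F) :
    False := by
  obtain ⟨t, ht, s, hs, hts⟩ := mem_diffs.1 h0
  have hts' : t ⊆ s := sdiff_eq_empty_iff_subset.1 hts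
  have hρ : Rstar (proj r F) ∈ proj r F := mem_proj_of_mem_part0 hρ0
  have htP : t ∈ proj r F := mem_proj_of_mem_partr ht
  have hsP : s ∈ proj r F := mem_proj_of_mem_part0 hs
  have htρ : ¬ t ⊆ Rstar (proj r F) := fun h =>
    not_mem_partr_of_mem_part0 hK (mem_part0_of_subset_Rstar hP hK hXY hρ0 hcore ha hρa t htP h) ht
  have hsρ : ¬ s ⊆ Rstar (proj r F) := fun h => htρ (hts'.trans h)
  have hsρ0 : s ∪ Rstar (proj r F) ∈ part0 r F := by
    have h : s ∪ Rstar (proj r F) ∉ partr r F := fun h =>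
      not_mem_partr_of_mem_part0 hK hs
        ((mem_partr_iff_union_Rstar_mem_partr hP hXY hρ0 hsP hsρ).2 h)
    exact mem_part0_of_notMem_partr (mem_union_Rstar_of_mem hP hsP) h
  have htρ1 : t ∪ Rstar (proj r F) ∈ partr r F :=
    (mem_partr_iff_union_Rstar_mem_partr hP hXY hρ0 htP htρ).1 ht
  -- a proper member `c ⊊ ρ` from the empty core
  obtain ⟨m, hm⟩ := nonempty_iff_ne_empty.2 (Rstar_proj_ne_empty hP hE ⟨s, hsP⟩)
  obtain ⟨p, hp, hmp⟩ := hcore m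
  have hcP : p ∩ Rstar (proj r F) ∈ proj r F := inter_Rstar_mem hP hp
  have hcρ : p ∩ Rstar (proj r F) ⊆ Rstar (proj r F) := inter_subset_right
  have hmc : m ∉ p ∩ Rstar (proj r F) := fun h => hmp (mem_inter.1 h).1
  -- `b := (s \ ρ) ∪ c` is a member with `(t ∪ ρ) \ b = ρ \ c`
  have hbP : (s \ Rstar (proj r F)) ∪ (p ∩ Rstar (proj r F)) ∈ proj r F :=
    sdiff_Rstar_union_inter_Rstar_mem hP hsP hp
  have hnY : Rstar (proj r F) \ (p ∩ Rstar (proj r F)) ∉ diffsY r F :=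
    sdiff_notMem_diffsY_of_part0_left hXY hρ0 hcP
      (fun h => hmc (sdiff_eq_empty_iff_subset.1 h hm))
  rw [← union_sdiff_sdiff_union_eq_of_subset hts' hcρ] at hnY
  have hb1 : (s \ Rstar (proj r F)) ∪ (p ∩ Rstar (proj r F)) ∈ partr r F :=
    mem_partr_of_sdiff_notMem_diffsY htρ1 hbP hnY
  have hbρ : ¬ (s \ Rstar (proj r F)) ∪ (p ∩ Rstar (proj r F)) ⊆ Rstar (proj r F) := by
    intro h
    apply hsρ
    intro x hx
    by_cases hxρ : x ∈ Rstar (proj r F)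
    · exact hxρ
    · exact h (mem_union_left _ (mem_sdiff.2 ⟨hx, hxρ⟩))
  have h := (mem_partr_iff_union_Rstar_mem_partr hP hXY hρ0 hbP hbρ).1 hb1
  rw [sdiff_union_union_eq_union_of_subset hcρ] at h
  exact not_mem_partr_of_mem_part0 hK hsρ0 h

/-- **Case `ρ ∈ F₀`, (d).** If no `r`-member contains `ρ`, every `r`-member lies inside `ρ` and
inside every member not inside `ρ` — impossible with an empty core. -/
theorem false_of_Rstar_mem_part0_of_forall (hP : Tight (proj r F))
    (hXY : diffsX r F ∩ diffsY r F = {∅}) (hρ0 : Rstar (proj r F) ∈ part0 r F)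
    (hE : (∅ : Finset α) ∉ proj r F) (hcore : ∀ a, ∃ p ∈ proj r F, a ∉ p)
    (hS : univ.erase r ∉ proj r F) (hsupp : ∀ a, a ≠ r → ∃ p ∈ proj r F, a ∈ p)
    (hne : (partr r F).Nonempty) (hno : ∀ a ∈ partr r F, ¬ Rstar (proj r F) ⊆ a) : False := by
  obtain ⟨b, hb⟩ := hne
  have hbP : b ∈ proj r F := mem_proj_of_mem_partr hb
  have hbρ : b ⊆ Rstar (proj r F) := by
    by_contra h
    exact hno _ ((mem_partr_iff_union_Rstar_mem_partr hP hXY hρ0 hbP h).1 hb) subset_union_right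
  obtain ⟨q, hq, hqρ⟩ := exists_mem_not_subset_Rstar hP hS hsupp ⟨b, hbP⟩
  -- every member not inside `ρ` is `r`-free and contains `b`
  have hsub : ∀ q ∈ proj r F, ¬ q ⊆ Rstar (proj r F) → b ⊆ q := by
    intro q hq hqρ
    have hq0 : q ∈ part0 r F :=
      mem_part0_of_notMem_partr hq (fun h =>
        hno _ ((mem_partr_iff_union_Rstar_mem_partr hP hXY hρ0 hq hqρ).1 h) subset_union_right)
    have hY : b \ q ∈ diffsY r F := sdiff_mem_diffsY_of_partr_part0 hb hq0
    have hwP : Rstar (proj r F) \ (b \ q) ∈ proj r F :=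
      Rstar_sdiff_mem_of_mem_diffs hP (mem_diffs.2 ⟨b, hbP, q, hq, rfl⟩)
    have e : Rstar (proj r F) \ (Rstar (proj r F) \ (b \ q)) = b \ q :=
      Finset.sdiff_sdiff_eq_self (sdiff_subset.trans hbρ)
    by_contra hbq
    have hne' : b \ q ≠ ∅ := fun h => hbq (sdiff_eq_empty_iff_subset.1 h)
    have h := sdiff_notMem_diffsY_of_part0_left hXY hρ0 hwP (by rw [e]; exact hne')
    rw [e] at h
    exact h hY
  have hbne : b ≠ ∅ := fun h => hE (h ▸ hbP)
  obtain ⟨m, hmb⟩ := nonempty_iff_ne_empty.2 hbne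
  obtain ⟨p, hp, hmp⟩ := hcore m
  have hp'P : (q \ Rstar (proj r F)) ∪ (p ∩ Rstar (proj r F)) ∈ proj r F :=
    sdiff_Rstar_union_inter_Rstar_mem hP hq hp
  have hp'ρ : ¬ (q \ Rstar (proj r F)) ∪ (p ∩ Rstar (proj r F)) ⊆ Rstar (proj r F) := by
    intro h
    apply hqρ
    intro x hx
    by_cases hxρ : x ∈ Rstar (proj r F)
    · exact hxρ
    · exact absurd (h (mem_union_left _ (mem_sdiff.2 ⟨hx, hxρ⟩))) hxρ
  have h := hsub _ hp'P hp'ρ hmb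
  rcases mem_union.1 h with h' | h'
  · exact (mem_sdiff.1 h').2 (hbρ hmb)
  · exact hmp (mem_inter.1 h').1

/-- **Case `ρ ∈ F₀` is impossible** (with `∅ ∈ Y`). -/
theorem false_of_Rstar_mem_part0 (hP : Tight (proj r F)) (hK : partner r F = ∅)
    (hXY : diffsX r F ∩ diffsY r F = {∅}) (hρ0 : Rstar (proj r F) ∈ part0 r F)
    (hE : (∅ : Finset α) ∉ proj r F) (hcore : ∀ a, ∃ p ∈ proj r F, a ∉ p)
    (hS : univ.erase r ∉ proj r F) (hsupp : ∀ a, a ≠ r → ∃ p ∈ proj r F, a ∈ p)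
    (h0 : (∅ : Finset α) ∈ diffsY r F) : False := by
  by_cases hex : ∃ a ∈ partr r F, Rstar (proj r F) ⊆ a
  · obtain ⟨a, ha, hρa⟩ := hex
    exact false_of_Rstar_mem_part0_of_exists hP hK hXY hρ0 hE hcore ha hρa h0
  · push Not at hex
    have hne : (partr r F).Nonempty := by
      obtain ⟨t, ht, -, -, -⟩ := mem_diffs.1 h0
      exact ⟨t, ht⟩
    exact false_of_Rstar_mem_part0_of_forall hP hXY hρ0 hE hcore hS hsupp hne hex

end CaseZero

end PercRepro.MSTight
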